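import Mathlib
import HarnessLib
import Literature.MathematicalPhysics.QuantumLattice.SectorisedKernelNormExtraction
import Literature.MathematicalPhysics.QuantumLattice.TorusCooperSum
import Summits.HubbardSuperconductivity.HubbardSuperconductivity.Theorems.KLProgrammeNonCooperKernelsDefs

/-!
# Route `KLProgramme`, crux K3 `KLRegimeTwoPointLimit` (stmt-HubbardSuperconductivity-19937) — a typing audit in Lean:
# the isotropic quartic ARRAY `klIsoArray` of `KLProgrammeNonCooperKernelsDefs` VANISHES IDENTICALLY below the ultraviolet scale

Cell gate-hubbard-kl, seat p1 (C1 lead, g5).  The (B3) clause `NonCooperFrozen` of child 1's sketch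
(HOME/p3/BetaSplitSketch.lean) and the (E2′) clause `IncrementsAt` of the engine sketch (HOME/p1/EngineBoundsSketch.lean) are stated
over `klIsoArray L M β U μ K e₀ n Ω̄ = ε_x³ Σ_{x₂,x₃,x₄} W̄_{n,Ω̄}(0, x₂, x₃, x₄)` — the sum over ALL positions of three legs of the
isotropic-sectorised quartic kernel (`klIsoCoeff … n 3`).  Summing a leg's position over the whole space-time lattice forces that leg's
LAB-FRAME spatial momentum to `0` (orthogonality of the torus characters), i.e. to the BOTTOM of the band, where `|e_K(0⃗)| ≈ 3 … 3.85`
on the analysis window; but the isotropic multiplier `F̄_{n,ω̄}(k) = C_h⁻¹(|(-ik₀, e_K(k⃗))|)·ζ̄(θ)` of the leg vanishes as soon as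
`|e_K(k⃗)| ≥ e₀ γ^{h} = e₀ 4^{-n}` (`gnScaleCutoff_eq_zero`).  Hence, for every `m ≥ 1`, every label tuple and every `n` with
`e₀ 4^{-n} ≤ |e_K(0⃗)|` (all `n ≥ 1` once `e₀ ≤ π`, and `n = 0` too once `e₀ ≤ 3 - ‖K‖`):

  `klIsoCoeff L M β U μ K e₀ n m Ω̄ = 0`,  in particular  `klIsoArray L M β U μ K e₀ n Ω̄ = 0`   (`klIsoCoeff_eq_zero`, `klIsoArray_eq_zero`).

CONSEQUENCE (design, not Lean): as typed, (B3) and (E2′) compare `0` with `0` and carry no information; the intended object — BGM's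
running coupling function READ AT THE SECTORS' FERMI MOMENTA (quasi-particle frame, BGM 2006 (2.60)–(2.64)) — needs either the
momentum-space EVALUATION of the quartic kernel at the sector-site momenta, or the fixed-tuple `L¹` norm of the sectorised INCREMENT
kernel `sectorisedKernel (klIsoFamily n) (klEffectiveAction n - klEffectiveAction (n-1)) 4` (both non-vacuous).  See the seat's STATUS line.

No analytic claim about the model is made here; the file is `--supports stmt-HubbardSuperconductivity-19937` evidence for the split typing.
References: HOME/p3/BetaSplitSketch.lean (B3); HOME/p1/EngineBoundsSketch.lean (E2′); BGM 2006 §2.5 (2.57), §2.6 (2.60)–(2.64).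
-/

noncomputable section

namespace Summit.HubbardSuperconductivity.HubbardSuperconductivity.Theorems.KLProgrammeLegKernels

set_option linter.dupNamespace false -- summit = problem name (single-conjunct summit), D-0017

open Real Finset Literature.MathematicalPhysics.QuantumLattice Literature.Probability.LatticeModels

variable {L M : ℕ} [NeZero L] [NeZero M]

omit [NeZero M] in
/-- **A plane wave summed over the whole space-time lattice vanishes unless its spatial momentum is `0`**
(orthogonality of the characters of `(ℤ/Lℤ)²`; the imaginary-time phase factors out). -/
theorem kliv_sum_hubbardPlaneWave_eq_zero (β : ℝ) (c : Fin 2) (k : FreqMomentum L M) (hk : k.2 ≠ 0) :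
    ∑ x : SpaceTimeIdx L M, hubbardPlaneWave L M β c k x = 0 := by
  simp_rw [hubbardPlaneWave_eq]
  rw [Fintype.sum_prod_type]
  simp_rw [← Finset.mul_sum]
  have hsp : (∑ y : TorusSite 2 L, if c = 0 then (starRingEnd ℂ) (torusChar k.2 y) else torusChar k.2 y) = 0 := by
    split_ifs with hc
    · rw [← map_sum, sum_torusChar_right, if_neg hk, map_zero]
    · rw [sum_torusChar_right, if_neg hk]
  simp [hsp]

omit [NeZero L] [NeZero M] in
/-- **The isotropic multiplier of scale `h = -n` vanishes at zero spatial momentum** as soon as `e₀ 4^{-n} ≤ |e_K(0⃗)|`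
(the band bottom is outside the support of the fields of scales `≤ h`). -/
theorem kliv_klIsoMultiplier_zero_momentum {e₀ : ℝ} (he : 0 < e₀) (β μ : ℝ) (K : TrigPolyC4v) (n : ℕ)
    (hIR : e₀ * ((4 : ℝ) ^ n)⁻¹ ≤ |nambuXiCT L μ K 0|) (ω : Fin (sectorCount (2 * n))) (j : MatsubaraIdx M) :
    klIsoMultiplier L M e₀ β (nambuXiCT L μ K) n ω (j, 0) = 0 := by
  rw [klIsoMultiplier]
  have hcut : gnScaleCutoff 4 e₀ (-(n : ℤ)) (Real.sqrt (matsubaraFreq β M j ^ 2 + nambuXiCT L μ K 0 ^ 2)) = 0 := by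
    apply gnScaleCutoff_eq_zero (by norm_num) he
    rw [zpow_neg, zpow_natCast]
    refine hIR.trans ?_
    rw [← Real.sqrt_sq_eq_abs]
    exact Real.sqrt_le_sqrt (by nlinarith [sq_nonneg (matsubaraFreq β M j)])
  simp [hcut]

/-- **The zero-momentum coefficients of the isotropic leg kernels vanish identically below the ultraviolet scale.**  For every
`m ≥ 1` (at least one integrated leg), every label tuple `Ω̄` and every scale index `n` with `e₀ 4^{-n} ≤ |e_K(0⃗)|`:
`klIsoCoeff L M β U μ K e₀ n m Ω̄ = 0`.  Reason: the position sum of an integrated leg forces its lab-frame spatial momentum to `0`,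
where the leg's isotropic multiplier vanishes. -/
theorem klIsoCoeff_eq_zero {e₀ : ℝ} (he : 0 < e₀) (β U μ : ℝ) (K : TrigPolyC4v) (n : ℕ)
    (hIR : e₀ * ((4 : ℝ) ^ n)⁻¹ ≤ |nambuXiCT L μ K 0|) {m : ℕ} (hm : 1 ≤ m)
    (Ω : Fin (m + 1) → SectorLeg (sectorCount (2 * n))) :
    klIsoCoeff L M β U μ K e₀ n m Ω = 0 := by
  rw [klIsoCoeff]
  refine mul_eq_zero_of_right _ ?_
  simp_rw [klLegKernel_eq, sectorisedKernel_def]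
  rw [Finset.sum_comm]
  refine Finset.sum_eq_zero fun k _ => ?_
  rw [← Finset.sum_mul]
  refine mul_eq_zero_of_left ?_ _
  -- split off leg `0` (pinned at the origin) and factorise the sum over the positions of the other legs
  simp_rw [Fin.prod_univ_succ, Matrix.cons_val_zero, Matrix.cons_val_succ, ← Finset.mul_sum]
  refine mul_eq_zero_of_right _ ?_
  rw [← Fintype.prod_sum (fun (i : Fin m) (y : SpaceTimeIdx L M) =>
    klIsoFamily L M β μ K e₀ n (Ω i.succ).1.1 (k i.succ) * hubbardPlaneWave L M β (Ω i.succ).2 (k i.succ) y)]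
  -- the factor of the first integrated leg vanishes
  apply Finset.prod_eq_zero (Finset.mem_univ (⟨0, hm⟩ : Fin m))
  simp_rw [← Finset.mul_sum]
  by_cases hk : (k (Fin.succ ⟨0, hm⟩)).2 = 0
  · refine mul_eq_zero_of_left ?_ _
    have : k (Fin.succ ⟨0, hm⟩) = ((k (Fin.succ ⟨0, hm⟩)).1, 0) := by rw [← hk]
    rw [this, klIsoFamily]
    exact kliv_klIsoMultiplier_zero_momentum he β μ K n hIR _ _
  · exact mul_eq_zero_of_right _ (kliv_sum_hubbardPlaneWave_eq_zero β _ _ hk)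

/-- **`klIsoArray` vanishes identically below the ultraviolet scale**: for every scale index `n` with `e₀ 4^{-n} ≤ |e_K(0⃗)|`
and every isotropic label 4-tuple, `klIsoArray L M β U μ K e₀ n Ω̄ = 0` — the (B3)/(E2′) carrier as typed is trivial. -/
theorem klIsoArray_eq_zero {e₀ : ℝ} (he : 0 < e₀) (β U μ : ℝ) (K : TrigPolyC4v) (n : ℕ)
    (hIR : e₀ * ((4 : ℝ) ^ n)⁻¹ ≤ |nambuXiCT L μ K 0|) (Ω : Fin 4 → SectorLeg (sectorCount (2 * n))) :
    klIsoArray L M β U μ K e₀ n Ω = 0 :=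
  klIsoCoeff_eq_zero he β U μ K n hIR (by norm_num) Ω

omit [NeZero L] in
/-- **The hypothesis holds on the analysis window for every frame of size `< 3 - e₀ 4^{-n}`**: `e_K(0⃗) = -4 - μ - K(0)`, so
`|e_K(0⃗)| ≥ 4 + μ - ‖K‖₀ ≥ 3 - ‖K‖₀` for `μ ≥ -1` (`‖K‖₀ = coeffNorm 0 K`; on the analysis window `μ ∈ [-1, -0.15]`); in particular
for the bare frame and `e₀ ≤ π` the array vanishes at EVERY `n ≥ 1`, and at `n = 0` too once `e₀ ≤ 3`. -/
theorem kliv_band_bottom_far {μ : ℝ} (hμ : -1 ≤ μ) (K : TrigPolyC4v) {e₀ : ℝ} (n : ℕ)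
    (hK : e₀ * ((4 : ℝ) ^ n)⁻¹ + K.coeffNorm 0 ≤ 3) :
    e₀ * ((4 : ℝ) ^ n)⁻¹ ≤ |nambuXiCT L μ K 0| := by
  rw [nambuXiCT, torusBand_zero]
  have hKev := TrigPolyC4v.abs_eval_le_coeffNorm K (latticeMomentum L 0)
  rw [abs_le] at hKev
  rw [le_abs]
  right
  push_cast
  linarith

/-- **Corollary (bare frame `K = 0`, `μ ≥ -1`, `0 < e₀ ≤ π`, every `n ≥ 1`)**: `klIsoArray L M β U μ 0 e₀ n Ω̄ = 0` for every
isotropic label 4-tuple — unconditionally in `(β, U, L, M)`. -/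
theorem klIsoArray_eq_zero_bare_frame {e₀ : ℝ} (he : 0 < e₀) (he' : e₀ ≤ Real.pi) (β U : ℝ) {μ : ℝ} (hμ : -1 ≤ μ)
    {n : ℕ} (hn : 1 ≤ n) (Ω : Fin 4 → SectorLeg (sectorCount (2 * n))) :
    klIsoArray L M β U μ 0 e₀ n Ω = 0 := by
  refine klIsoArray_eq_zero he β U μ 0 n (kliv_band_bottom_far (L := L) hμ 0 n ?_) Ω
  have h4 : (4 : ℝ) ≤ 4 ^ n := by
    calc (4 : ℝ) = 4 ^ 1 := by norm_num
      _ ≤ 4 ^ n := pow_le_pow_right₀ (by norm_num) hn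
  have hc : TrigPolyC4v.coeffNorm 0 (0 : TrigPolyC4v) = 0 := by
    simp [TrigPolyC4v.coeffNorm]
  rw [hc, add_zero]
  have hpi := Real.pi_lt_four
  calc e₀ * ((4 : ℝ) ^ n)⁻¹ ≤ Real.pi * (4 : ℝ)⁻¹ := by
        apply mul_le_mul he' _ (by positivity) Real.pi_pos.le
        exact inv_anti₀ (by norm_num) h4
    _ ≤ 3 := by nlinarith

end Summit.HubbardSuperconductivity.HubbardSuperconductivity.Theorems.KLProgrammeLegKernels

end
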